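import Summits.Schanuel.Schanuel.Theorems.RootDecomp1BTwoRadical01

/-!
# RootDecomp1BTwoRadical — lens 4, generation 44, node 2 (g44b) «TWO-RADICAL DESCENT — t(1, ρ) = 5 AT THE RATIONAL COLUMN FOR EVERY ULTRA-LIOUVILLE ρ, HYPOTHESIS-FREE» (lanes B-R29 (ii) ∩ B-R30 (iv)/(d); CLAIM L2259, NODE L2268 / REQUEST L2269; critic VERDICT pending at staging — filed only on GO) — continuation (RootDecomp1BTwoRadical02): §C2 the specialisation and sizes

(lens-4 g44b HOME kernel K = HOME/decomp-schanuel-lens-4/g44b/TwoRadical.lean b925f14a…, 1327 l, imports tree `…RootDecomp1BFactDischarge01` ONLY; P/C per NODE.md. Port by census-1 gen 19 as `RootDecomp1BTwoRadical01`–`05` from the CENSUS CAP EDITION TwoRadical.capped.lean (census/tools/gen19/ports/tr/; = K with steps (2)–(5) of the kernel extracted as the public lemma `twoRadical_clash`, kernel statement BYTE-IDENTICAL, 53/53 decls identical + 1 new — same cut as TwoStorey's, RESHAPE RULE L1684): 01 = §A2 formal algebra of TWO radicals (`fiber_sum₂`, `powSubst₂`, `residue_lemma₂`, the q²×q² norm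 form `radMat₂`, `det_radMat₂_ne_zero`, `det_eq_eigen_mul₂`); 02 = §C2 the specialisation (`Cf₂`, `Frel₂`, sizes, Lipschitz, `eigen_eq_Frel₂` — TwoRadical's own versions, namespace-distinct from TwoStorey's); 03 = §D2 part 1: the private helper + the CLASH ENGINE `twoRadical_clash`; 04 = §D2 part 2: THE KERNEL `algebraicIndependent_twoRadical` (scoped `maxHeartbeats 1600000` as in K); 05 = §E2 cells mod `(hLW : LWMeasure)` + §F2 hypothesis-free via `lwMeasure_holds` (`five_le_polarDeg_one_ultra : ((5 : ℕ) : Cardinal) ≤ polarDeg ![(1:ℝ), ρ]` for EVERY ultra-Liouville ρ, `five_le_polarDeg_one_rhoU`, …) + §G2 the coordinate column at every storey (`polarDeg_snoc_ultra₂`, …).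
PORT EDITS: linter option dropped; one docstring added (`powSubst₂_apply`); §D2 re-cut for the 400-line cap (one new public lemma `twoRadical_clash`; eigenvector coordinates abstracted as `w` with `‖w c‖ ≤ Θ^q·Θ^q`, eigenvalue as `Φ`; thirteen now-unused local `have`s of the kernel dropped); every other statement and proof verbatim. `--supports stmt-Schanuel-24622`; no census credit carried; rung 0 — nothing here proves Schanuel.)
-/

noncomputable section

open Complex

namespace Summit.Schanuel.Schanuel.Theorems.RootDecomp1BTwoRadical

/-! ## §C2 THE SPECIALISATION: `C_{kk'} := q^J [U^k V^{k'}] P(U, V, p/q, X)`, `F(x) := P(e^{x y₀}, e^{x y₁}, x, θ)`, sizes -/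

section Special

open MvPolynomial
open Summit.Schanuel.Schanuel.Theorems.RootDecomp1KHyper (mvlen mvlen_nonneg mvlen_eq_sum_of_support_subset
  abs_coeff_le_mvlen one_le_mvlen)
open RootDecomp1BRadicalDescent (resFin)

variable {n : ℕ}

/-- The length of a monomial `c · x^m` is at most `|c|` (local copy of the file-private g30 helper). -/
private theorem mvlen_monomial_le (m : Fin n →₀ ℕ) (c : ℤ) : mvlen (monomial m c) ≤ |c| := by
  classical
  rw [mvlen_eq_sum_of_support_subset _ support_monomial_subset, Finset.sum_singleton, coeff_monomial,
    if_pos rfl]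

/-- The length of the zero polynomial is `0`. -/
private theorem mvlen_zero : mvlen (0 : MvPolynomial (Fin n) ℤ) = 0 := by simp [mvlen]

/-- Subadditivity of the length. -/
private theorem mvlen_add_le (P Q : MvPolynomial (Fin n) ℤ) : mvlen (P + Q) ≤ mvlen P + mvlen Q := by
  classical
  rw [mvlen_eq_sum_of_support_subset _ support_add,
    mvlen_eq_sum_of_support_subset P (Finset.subset_union_left (s₂ := Q.support)),
    mvlen_eq_sum_of_support_subset Q (Finset.subset_union_right (s₁ := P.support)),
    ← Finset.sum_add_distrib]
  exact Finset.sum_le_sum fun m _ => by rw [coeff_add]; exact abs_add_le _ _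

/-- The length of a finite sum is at most the sum of the lengths. -/
private theorem mvlen_sum_le {ι : Type*} (s : Finset ι) (f : ι → MvPolynomial (Fin n) ℤ) :
    mvlen (∑ i ∈ s, f i) ≤ ∑ i ∈ s, mvlen (f i) := by
  classical
  induction s using Finset.induction_on with
  | empty => simp [mvlen_zero]
  | insert a s ha ih =>
    rw [Finset.sum_insert ha, Finset.sum_insert ha]
    exact (mvlen_add_le _ _).trans (by linarith)

/-- `mvlen (P · c x^a) ≤ mvlen P · |c|`. -/
private theorem mvlen_mul_monomial_le (P : MvPolynomial (Fin n) ℤ) (a : Fin n →₀ ℕ) (b : ℤ) :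
    mvlen (P * monomial a b) ≤ mvlen P * |b| := by
  classical
  have hP : P * monomial a b = ∑ m ∈ P.support, monomial (m + a) (P.coeff m * b) := by
    conv_lhs => rw [P.as_sum]
    rw [Finset.sum_mul]
    exact Finset.sum_congr rfl fun m _ => monomial_mul
  rw [hP]
  calc mvlen (∑ m ∈ P.support, monomial (m + a) (P.coeff m * b))
      ≤ ∑ m ∈ P.support, mvlen (monomial (m + a) (P.coeff m * b)) := mvlen_sum_le _ _
    _ ≤ ∑ m ∈ P.support, |P.coeff m| * |b| :=
        Finset.sum_le_sum fun m _ => (mvlen_monomial_le _ _).trans_eq (abs_mul _ _)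
    _ = mvlen P * |b| := by rw [← Finset.sum_mul]; rfl

/-- `mvlen (P · X_i^e · X_j^f) ≤ mvlen P`. -/
private theorem mvlen_mul_X_pow_mul_X_pow_le (P : MvPolynomial (Fin n) ℤ) (i j : Fin n) (e f : ℕ) :
    mvlen (P * X i ^ e * X j ^ f) ≤ mvlen P := by
  rw [mul_assoc, X_pow_eq_monomial, X_pow_eq_monomial, monomial_mul, mul_one]
  simpa using mvlen_mul_monomial_le P (Finsupp.single i e + Finsupp.single j f) 1

/-- The `X`-part (coordinates `3, …, n+2`) of an exponent vector on `Fin (n+3)` (coordinate `0` is the first radical's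
variable `U`, coordinate `1` the second radical's variable `V`, coordinate `2` the Liouville variable `Y`). -/
def sX₃ (s : Fin (n + 3) →₀ ℕ) : Fin n →₀ ℕ := Finsupp.tail (Finsupp.tail (Finsupp.tail s))

/-- Coordinates of the `X`-part: `sX₃ s j = s (j+3)`. -/
theorem sX₃_apply (s : Fin (n + 3) →₀ ℕ) (j : Fin n) : sX₃ s j = s j.succ.succ.succ := by
  simp [sX₃, Finsupp.tail_apply]

/-- An exponent vector on `Fin (n+3)` is determined by its coordinates `0`, `1`, `2` and its `X`-part. -/
theorem eq_of_parts₃ {s s' : Fin (n + 3) →₀ ℕ} (h0 : s 0 = s' 0) (h1 : s 1 = s' 1) (h2 : s 2 = s' 2)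
    (hX : sX₃ s = sX₃ s') : s = s' := by
  ext i
  refine Fin.cases ?_ (fun i' => Fin.cases ?_ (fun i'' => Fin.cases ?_ (fun j => ?_) i'') i') i
  · exact h0
  · simpa using h1
  · simpa using h2
  · have := congrArg (fun f : Fin n →₀ ℕ => f j) hX
    simpa [sX₃_apply] using this

variable (P : MvPolynomial (Fin (n + 3)) ℤ) (p q J : ℕ)

/-- `C_{kk'} := q^J · [U^k V^{k'}] P(U, V, p/q, X) ∈ ℤ[X]` — the specialised `U^k V^{k'}`-coefficient. -/
def Cf₂ (kk : ℕ × ℕ) : MvPolynomial (Fin n) ℤ :=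
  ∑ s ∈ P.support with (s 0, s 1) = kk, monomial (sX₃ s) (P.coeff s * (p : ℤ) ^ (s 2) * (q : ℤ) ^ (J - s 2))

/-- The specialised coefficients `C_{kk'}` have total degree `≤ deg P`. -/
theorem totalDegree_Cf₂_le (kk : ℕ × ℕ) : (Cf₂ P p q J kk).totalDegree ≤ P.totalDegree := by
  unfold Cf₂
  refine totalDegree_finsetSum_le fun s hs => ?_
  refine (totalDegree_monomial_le _ _).trans ?_
  have hs' : s ∈ P.support := (Finset.mem_filter.1 hs).1
  refine le_trans ?_ (le_totalDegree hs')
  rw [Finsupp.sum_fintype _ _ (fun _ => rfl), Finsupp.sum_fintype _ _ (fun _ => rfl),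
    Fin.sum_univ_succ, Fin.sum_univ_succ, Fin.sum_univ_succ]
  simp only [sX₃_apply, id]
  omega

/-- Length bound `mvlen C_{kk'} ≤ mvlen P · (p + q)^J` (when every `Y`-exponent of `P` is `≤ J`). -/
theorem mvlen_Cf₂_le (hJ : ∀ s ∈ P.support, s 2 ≤ J) (kk : ℕ × ℕ) :
    mvlen (Cf₂ P p q J kk) ≤ mvlen P * ((p : ℤ) + q) ^ J := by
  classical
  unfold Cf₂
  have hp0 : (0 : ℤ) ≤ p := Nat.cast_nonneg _
  have hq0 : (0 : ℤ) ≤ q := Nat.cast_nonneg _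
  calc mvlen (∑ s ∈ P.support with (s 0, s 1) = kk,
        monomial (sX₃ s) (P.coeff s * (p : ℤ) ^ (s 2) * (q : ℤ) ^ (J - s 2)))
      ≤ ∑ s ∈ P.support with (s 0, s 1) = kk,
        mvlen (monomial (sX₃ s) (P.coeff s * (p : ℤ) ^ (s 2) * (q : ℤ) ^ (J - s 2))) :=
        mvlen_sum_le _ _
    _ ≤ ∑ s ∈ P.support with (s 0, s 1) = kk, |P.coeff s| * ((p : ℤ) + q) ^ J :=
        Finset.sum_le_sum fun s hs => by
          refine (mvlen_monomial_le _ _).trans ?_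
          rw [abs_mul, abs_mul, abs_pow, abs_pow, abs_of_nonneg hp0, abs_of_nonneg hq0, mul_assoc]
          refine mul_le_mul_of_nonneg_left ?_ (abs_nonneg _)
          have h1 := hJ s (Finset.mem_filter.1 hs).1
          calc (p : ℤ) ^ (s 2) * (q : ℤ) ^ (J - s 2)
              ≤ ((p : ℤ) + q) ^ (s 2) * ((p : ℤ) + q) ^ (J - s 2) :=
                mul_le_mul (pow_le_pow_left₀ hp0 (by linarith) _)
                  (pow_le_pow_left₀ hq0 (by linarith) _) (by positivity) (by positivity)
            _ = ((p : ℤ) + q) ^ J := by rw [← pow_add, Nat.add_sub_cancel' h1]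
    _ ≤ ∑ s ∈ P.support, |P.coeff s| * ((p : ℤ) + q) ^ J :=
        Finset.sum_le_sum_of_subset_of_nonneg (Finset.filter_subset _ _)
          (fun _ _ _ => by positivity)
    _ = mvlen P * ((p : ℤ) + q) ^ J := by rw [← Finset.sum_mul]; rfl

/-- Entry length bound for the two-radical norm-form matrix: `mvlen (radMat₂ C K p)_{ll', aa'} ≤ (K+1)² · E₁`. -/
theorem mvlen_radMat₂_le {K : ℕ} (hq : 0 < q) (i₀ i₁ : Fin n) {E₁ : ℤ}
    (hE : ∀ kk, mvlen (Cf₂ P p q J kk) ≤ E₁) (hE0 : 0 ≤ E₁) (ll aa : Fin q × Fin q) :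
    mvlen (radMat₂ (Cf₂ P p q J) K p hq i₀ i₁ ll aa) ≤ ((K : ℤ) + 1) ^ 2 * E₁ := by
  unfold radMat₂
  calc mvlen (∑ kk ∈ (Finset.range (K + 1) ×ˢ Finset.range (K + 1)).filter
          (fun kk => (resFin hq (p * kk.1 + ll.1), resFin hq (p * kk.2 + ll.2)) = aa),
        Cf₂ P p q J kk * X i₀ ^ ((p * kk.1 + ll.1) / q) * X i₁ ^ ((p * kk.2 + ll.2) / q))
      ≤ ∑ kk ∈ (Finset.range (K + 1) ×ˢ Finset.range (K + 1)).filter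
          (fun kk => (resFin hq (p * kk.1 + ll.1), resFin hq (p * kk.2 + ll.2)) = aa),
        mvlen (Cf₂ P p q J kk * X i₀ ^ ((p * kk.1 + ll.1) / q) * X i₁ ^ ((p * kk.2 + ll.2) / q)) :=
        mvlen_sum_le _ _
    _ ≤ ∑ kk ∈ (Finset.range (K + 1) ×ˢ Finset.range (K + 1)).filter
          (fun kk => (resFin hq (p * kk.1 + ll.1), resFin hq (p * kk.2 + ll.2)) = aa), E₁ :=
        Finset.sum_le_sum fun kk _ => (mvlen_mul_X_pow_mul_X_pow_le _ _ _ _ _).trans (hE kk)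
    _ ≤ ∑ _kk ∈ Finset.range (K + 1) ×ˢ Finset.range (K + 1), E₁ :=
        Finset.sum_le_sum_of_subset_of_nonneg (Finset.filter_subset _ _) (fun _ _ _ => hE0)
    _ = ((K : ℤ) + 1) ^ 2 * E₁ := by
        rw [Finset.sum_const, Finset.card_product, Finset.card_range, nsmul_eq_mul]; push_cast; ring

/-- Entry degree bound for the two-radical norm-form matrix: `deg ≤ deg P + 2·B·K` when `p ≤ B q`. -/
theorem totalDegree_radMat₂_le {K B : ℕ} (hq : 0 < q) (i₀ i₁ : Fin n) (hp : p ≤ B * q) (ll aa : Fin q × Fin q) :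
    (radMat₂ (Cf₂ P p q J) K p hq i₀ i₁ ll aa).totalDegree ≤ P.totalDegree + 2 * (B * K) := by
  unfold radMat₂
  refine totalDegree_finsetSum_le fun kk hkk => ?_
  have hkk' := Finset.mem_product.1 (Finset.mem_filter.1 hkk).1
  have hk1 : kk.1 ≤ K := Nat.lt_succ_iff.1 (Finset.mem_range.1 hkk'.1)
  have hk2 : kk.2 ≤ K := Nat.lt_succ_iff.1 (Finset.mem_range.1 hkk'.2)
  have hdiv : ∀ (k : ℕ) (l : Fin q), k ≤ K → (p * k + l) / q ≤ B * K := by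
    intro k l hk
    calc (p * k + l) / q ≤ (B * q * K + l) / q :=
          Nat.div_le_div_right (by nlinarith [Nat.mul_le_mul hp hk])
      _ = B * K + l / q := by
          rw [show B * q * K + (l : ℕ) = q * (B * K) + l by ring, Nat.mul_add_div hq]
      _ = B * K := by rw [Nat.div_eq_of_lt l.isLt, add_zero]
  have h1 : (Cf₂ P p q J kk * X i₀ ^ ((p * kk.1 + ll.1) / q)).totalDegree ≤ P.totalDegree + B * K := by
    refine (totalDegree_mul _ _).trans (add_le_add (totalDegree_Cf₂_le P p q J kk) ?_)
    rw [totalDegree_X_pow]; exact hdiv kk.1 ll.1 hk1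
  have h2 : (X i₁ ^ ((p * kk.2 + ll.2) / q) : MvPolynomial (Fin n) ℤ).totalDegree ≤ B * K := by
    rw [totalDegree_X_pow]; exact hdiv kk.2 ll.2 hk2
  refine (totalDegree_mul _ _).trans ?_
  linarith

/-- Evaluation of `C_{kk'}` at `θ`, expanded over the monomials of `P` with `(U,V)`-exponent `kk'`. -/
theorem aeval_Cf₂ (θ : Fin n → ℂ) (kk : ℕ × ℕ) :
    aeval θ (Cf₂ P p q J kk) = ∑ s ∈ P.support with (s 0, s 1) = kk,
      (((P.coeff s * (p : ℤ) ^ (s 2) * (q : ℤ) ^ (J - s 2) : ℤ)) : ℂ) * ∏ j, θ j ^ (s j.succ.succ.succ) := by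
  unfold Cf₂
  rw [map_sum]
  refine Finset.sum_congr rfl fun s _ => ?_
  rw [aeval_monomial, algebraMap_int_eq, eq_intCast, Finsupp.prod_fintype _ _ (fun _ => by simp)]
  simp only [sX₃_apply]

/-- `F(x) := P(e^{x y₀}, e^{x y₁}, x, θ)`, expanded monomially: a `C¹` map `ℝ → ℂ`. -/
def Frel₂ (θ : Fin n → ℂ) (y₀ y₁ : ℂ) (x : ℝ) : ℂ :=
  ∑ s ∈ P.support, ((P.coeff s : ℤ) : ℂ) *
    (cexp ((x : ℂ) * y₀) ^ (s 0) * (cexp ((x : ℂ) * y₁) ^ (s 1) * ((x : ℂ) ^ (s 2) * ∏ j, θ j ^ (s j.succ.succ.succ))))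

/-- `F(x) = P(e^{x y₀}, e^{x y₁}, x, θ)` as an `MvPolynomial.aeval`. -/
theorem Frel₂_eq_aeval (θ : Fin n → ℂ) (y₀ y₁ : ℂ) (x : ℝ) :
    Frel₂ P θ y₀ y₁ x =
      aeval (Fin.cons (cexp ((x : ℂ) * y₀)) (Fin.cons (cexp ((x : ℂ) * y₁)) (Fin.cons (x : ℂ) θ)) :
        Fin (n + 3) → ℂ) P := by
  unfold Frel₂
  rw [MvPolynomial.aeval_def, MvPolynomial.eval₂_eq']
  refine Finset.sum_congr rfl fun s _ => ?_
  rw [Fin.prod_univ_succ, Fin.prod_univ_succ, Fin.prod_univ_succ]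
  simp only [algebraMap_int_eq, eq_intCast, Fin.cons_zero, Fin.cons_succ]
  rfl

/-- `F` is `C¹` on `ℝ`. -/
theorem contDiff_Frel₂ (θ : Fin n → ℂ) (y₀ y₁ : ℂ) : ContDiff ℝ 1 (Frel₂ P θ y₀ y₁) := by
  have hx : ContDiff ℝ 1 (fun x : ℝ => (x : ℂ)) := Complex.ofRealCLM.contDiff
  show ContDiff ℝ 1 (fun x => Frel₂ P θ y₀ y₁ x)
  unfold Frel₂
  refine ContDiff.sum fun s _ => ?_
  refine contDiff_const.mul (((Complex.contDiff_exp.comp (hx.mul contDiff_const)).pow _).mul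
    ((((Complex.contDiff_exp.comp (hx.mul contDiff_const)).pow _)).mul ((hx.pow _).mul contDiff_const)))

/-- local Lipschitz bound of `Frel₂` at `ρ` -/
theorem exists_lipschitz_Frel₂ (θ : Fin n → ℂ) (y₀ y₁ : ℂ) (ρ : ℝ) :
    ∃ Kl δ₁ : ℝ, 0 ≤ Kl ∧ 0 < δ₁ ∧
      ∀ x : ℝ, |x - ρ| < δ₁ → ‖Frel₂ P θ y₀ y₁ x - Frel₂ P θ y₀ y₁ ρ‖ ≤ Kl * |x - ρ| := by
  obtain ⟨K, t, ht, hK⟩ := ((contDiff_Frel₂ P θ y₀ y₁).contDiffAt (x := ρ)).exists_lipschitzOnWith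
  obtain ⟨δ₁, hδ₁, hball⟩ := Metric.mem_nhds_iff.mp ht
  refine ⟨K, δ₁, K.2, hδ₁, fun x hx => ?_⟩
  have hxt : x ∈ t := hball (by rw [Metric.mem_ball, Real.dist_eq]; exact hx)
  have hρt : ρ ∈ t := hball (Metric.mem_ball_self hδ₁)
  have := (lipschitzOnWith_iff_dist_le_mul.mp hK) x hxt ρ hρt
  rwa [dist_eq_norm, Real.dist_eq] at this

/-- **The eigenvalue is `q^J F(p/q)`**: `Σ_{k,k'} C_{kk'}(θ) w^{pk} w'^{pk'} = q^J · F(p/q)` when `w^p = e^{(p/q) y₀}`,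
`w'^p = e^{(p/q) y₁}`. -/
theorem eigen_eq_Frel₂ (θ : Fin n → ℂ) (y₀ y₁ : ℂ) {K : ℕ} (hK : ∀ s ∈ P.support, s 0 ≤ K ∧ s 1 ≤ K)
    (hJ : ∀ s ∈ P.support, s 2 ≤ J) (hq : 0 < q) (w w' : ℂ)
    (hw : w ^ p = cexp (((((p : ℝ) / q : ℝ)) : ℂ) * y₀)) (hw' : w' ^ p = cexp (((((p : ℝ) / q : ℝ)) : ℂ) * y₁)) :
    ∑ kk ∈ Finset.range (K + 1) ×ˢ Finset.range (K + 1), aeval θ (Cf₂ P p q J kk) * (w ^ (p * kk.1) * w' ^ (p * kk.2)) =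
      (q : ℂ) ^ J * Frel₂ P θ y₀ y₁ ((p : ℝ) / q) := by
  classical
  have hqC : (q : ℂ) ≠ 0 := by exact_mod_cast hq.ne'
  simp_rw [aeval_Cf₂, Finset.sum_mul]
  have step : ∀ kk ∈ Finset.range (K + 1) ×ˢ Finset.range (K + 1),
      ∑ s ∈ P.support with (s 0, s 1) = kk,
        (((P.coeff s * (p : ℤ) ^ (s 2) * (q : ℤ) ^ (J - s 2) : ℤ)) : ℂ) *
          (∏ j, θ j ^ (s j.succ.succ.succ)) * (w ^ (p * kk.1) * w' ^ (p * kk.2)) =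
      ∑ s ∈ P.support with (s 0, s 1) = kk,
        (q : ℂ) ^ J * (((P.coeff s : ℤ) : ℂ) *
          (cexp (((((p : ℝ) / q : ℝ)) : ℂ) * y₀) ^ (s 0) * (cexp (((((p : ℝ) / q : ℝ)) : ℂ) * y₁) ^ (s 1) *
            (((((p : ℝ) / q : ℝ)) : ℂ) ^ (s 2) * ∏ j, θ j ^ (s j.succ.succ.succ))))) := by
    intro kk _
    refine Finset.sum_congr rfl fun s hs => ?_
    have hsk : (s 0, s 1) = kk := (Finset.mem_filter.1 hs).2
    have hs0 : s 0 = kk.1 := (congrArg Prod.fst hsk)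
    have hs1 : s 1 = kk.2 := (congrArg Prod.snd hsk)
    have hs2 : s 2 ≤ J := hJ s (Finset.mem_filter.1 hs).1
    rw [← hs0, ← hs1, pow_mul, pow_mul, hw, hw']
    have hpq : (p : ℂ) ^ (s 2) * (q : ℂ) ^ (J - s 2) =
        (q : ℂ) ^ J * (((((p : ℝ) / q : ℝ)) : ℂ)) ^ (s 2) := by
      rw [← pow_sub_mul_pow (q : ℂ) hs2]
      push_cast
      rw [div_pow]
      field_simp
    simp only [Int.cast_mul, Int.cast_pow, Int.cast_natCast]
    linear_combination (((P.coeff s : ℤ) : ℂ) * (∏ j, θ j ^ (s j.succ.succ.succ)) *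
      cexp (((((p : ℝ) / q : ℝ)) : ℂ) * y₀) ^ (s 0) * cexp (((((p : ℝ) / q : ℝ)) : ℂ) * y₁) ^ (s 1)) * hpq
  rw [Finset.sum_congr rfl step,
    Finset.sum_fiberwise_of_maps_to (g := fun s => (s 0, s 1))
      (fun s hs => Finset.mem_product.2 ⟨Finset.mem_range.2 (Nat.lt_succ_of_le (hK s hs).1),
        Finset.mem_range.2 (Nat.lt_succ_of_le (hK s hs).2)⟩),
    ← Finset.mul_sum]
  rfl

end Special

end Summit.Schanuel.Schanuel.Theorems.RootDecomp1BTwoRadical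

end
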